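import Mathlib.Tactic.Group
import Literature.AnabelianGeometry.SemiGraphs.TemperedFunctorialityProofs
import Literature.AnabelianGeometry.SemiGraphs.TemperedFunctorialityWithHom
import Literature.AnabelianGeometry.EtaleTheta.CyclotomicEnvelope
import HarnessLib

/-!
# [SemiAnbd] Thm 5.4 (iii) at the outer models: the EQUIVARIANCE datum of `B^temp(φ)` from the
# functoriality 2-cells of the dictionary (Prop 3.2) — the input `hrep` of `compat_of_representatives`

Mochizuki, *Semi-graphs of anabelioids*, Publ. RIMS **42** (2006), §3 Prop 3.2 p. 35 ("any morphism
`B^temp(Π₁) → B^temp(Π₂)` arises from a continuous homomorphism, unique up to composition with an inner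
automorphism"), Prop 3.6 (iv) p. 39, §5 Def 5.1 (i)/(iv) pp. 62–63, Thm 5.4 (iii) p. 66
[cite: MochizukiSemiAnbd2006, Thm 5.4 (iii) p.66].

PROOF-ONLY (no definition; cell abc-iut, layer L3, T54 row «T54iii·btemp-outerModel», piece 3, seat
abc-iut-w4-d053 gen 4).  `outerSemidirectProductMap` (`ArithBTempOuterModel.lean`, this seat; NOT imported —
no olean dependency) builds `B^temp(φ) : π₁^temp(𝒢) ⋊^out Π_A → π₁^temp(ℋ) ⋊^out Π_{A′}` from a chart-level
`φ̂` and the datum `hrep` of its `compat_of_representatives`: «every `a ∈ Π_A` has representatives `β` of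
`ρ_𝒢(a)` and `β′` of `ρ_ℋ(e a)` with `β′ ∘ φ̂ = φ̂ ∘ β`».  Here `hrep` is DERIVED from the data the T54
junction umbrella (abc-iut-w5-d141, `ArithThm54iiiUmbrellaOfChartDict.lean`) and abc-iut-w4-d089's
outer-model corollary already bind:

* the graph actions REPRESENTED ON THE CHARTS by representatives of the outer classes — the `hrep`
  binders of abc-iut-w5-d141's `hact_outerSemidirectProduct` (`hrep𝒢`, `hrepℋ` below, verbatim shape);
* ONE functorial square per `a` between the pull-back functors:
  `B^temp(φ̂) ⋙ (F_𝒢 a)^*_θ ≅ (F_ℋ a)^*_θ ⋙ B^temp(φ̂)` (`hsq`) — which the consumer pastes from the umbrella's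
  `hφc`, `hpre a g₀`, `hpost a g₀` and the equivariance `ρ_𝔾(a) ≫ g₀ = g₀ ≫ ρ_ℍ(e a)` of the arrow
  `g₀ = φ.geom` (`ArithHom.compat`).

Prop 3.2 (`BTemp.exists_conj_of_natTrans`) turns the square into `c_η ∘ φ̂ = conj k ∘ φ̂ ∘ c_γ`, and the
inner twist `conj k⁻¹ ∘ β′` is the wanted representative.  Nothing here bears on [IUTchIII] Cor. 3.12;
typed ≠ proved elsewhere.
-/

namespace Literature.AnabelianGeometry.SemiGraphs

namespace ProfiniteSemiGraph

open CategoryTheory Literature.AnabelianGeometry.EtaleTheta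

universe u w w'

variable {𝒢 ℋ : ProfiniteSemiGraph.{u}} (c𝒢 : TemperedPiChart 𝒢) (cℋ : TemperedPiChart ℋ)
  {PA : Type w} [Group PA] {PA' : Type w'} [Group PA']
  (ρ𝒢 : PA →* TopOut c𝒢.G) (ρℋ : PA' →* TopOut cℋ.G) (e : PA →* PA') (φ : c𝒢.G →ₜ* cℋ.G)

/-- **Prop 3.2 on a functorial square**: if the chart representatives `c_γ` of `(F_𝒢 a)^*` and `c_η` of
`(F_ℋ a)^*` fit into `B^temp(φ̂) ⋙ B^temp(c_γ) ≅ B^temp(c_η) ⋙ B^temp(φ̂)`, then `c_η ∘ φ̂` and `φ̂ ∘ c_γ` are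
conjugate in `π₁^temp(ℋ)`. [cite: MochizukiSemiAnbd2006, Prop 3.2 p.35] -/
theorem exists_conj_of_resSquare (cγ : c𝒢.G →ₜ* c𝒢.G) (cη : cℋ.G →ₜ* cℋ.G)
    (hsq : Nonempty (BTemp.res φ ⋙ BTemp.res cγ ≅ BTemp.res cη ⋙ BTemp.res φ)) :
    ∃ k : cℋ.G, ∀ y, cη (φ y) = k * φ (cγ y) * k⁻¹ := by
  obtain ⟨η⟩ := hsq
  obtain ⟨k, hk, -⟩ := BTemp.exists_conj_of_natTrans cℋ.isTempered (φ.comp cγ) (cη.comp φ)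
    ((BTemp.resComp φ cγ).symm ≪≫ η ≪≫ BTemp.resComp cη φ).hom
  exact ⟨k, fun y => (hk y).symm⟩

/-- **The equivariance datum `hrep` of `B^temp(φ)` at the outer models, from the dictionary's functorial
squares**: given, for every `a ∈ Π_A`, representatives `β_a` of `ρ_𝒢(a)` and `β′_a` of `ρ_ℋ(e a)` realising
the graph actions on the charts (`(F_𝒢 a)^*_θ ≅ B^temp(β_a)`, `(F_ℋ a)^*_θ ≅ B^temp(β′_a)` — the `hrep` binders
of `hact_outerSemidirectProduct`) and the functorial square `B^temp(φ̂) ⋙ (F_𝒢 a)^*_θ ≅ (F_ℋ a)^*_θ ⋙ B^temp(φ̂)`,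
every `a` has representatives `β` of `ρ_𝒢(a)`, `β′` of `ρ_ℋ(e a)` with `β′ ∘ φ̂ = φ̂ ∘ β` ON THE NOSE — the
hypothesis `hrep` of `compat_of_representatives ρ𝒢 ρℋ e φ̂` (`ArithBTempOuterModel.lean`).
[cite: MochizukiSemiAnbd2006, Thm 5.4 (iii) p.66] -/
theorem btemp_representatives_of_squares [IsTopologicalGroup cℋ.G]
    (F𝒢 : PA → Hom 𝒢 𝒢) (θ𝒢 : ∀ a, (F𝒢 a).ConjugatorFamily)
    (Fℋ : PA → Hom ℋ ℋ) (θℋ : ∀ a, (Fℋ a).ConjugatorFamily)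
    (hrep𝒢 : ∀ a, ∃ (β : contMulAut c𝒢.G) (cγ : c𝒢.G →ₜ* c𝒢.G), TopOut.mk c𝒢.G β = ρ𝒢 a ∧
      (∀ t, (β : MulAut c𝒢.G) t = cγ t) ∧ Nonempty ((F𝒢 a).chartPullbackWith (θ𝒢 a) c𝒢 c𝒢 ≅ BTemp.res cγ))
    (hrepℋ : ∀ a, ∃ (β' : contMulAut cℋ.G) (cη : cℋ.G →ₜ* cℋ.G), TopOut.mk cℋ.G β' = ρℋ (e a) ∧
      (∀ t, (β' : MulAut cℋ.G) t = cη t) ∧ Nonempty ((Fℋ a).chartPullbackWith (θℋ a) cℋ cℋ ≅ BTemp.res cη))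
    (hsq : ∀ a, Nonempty (BTemp.res φ ⋙ (F𝒢 a).chartPullbackWith (θ𝒢 a) c𝒢 c𝒢 ≅
      (Fℋ a).chartPullbackWith (θℋ a) cℋ cℋ ⋙ BTemp.res φ)) :
    ∀ a : PA, ∃ β : contMulAut c𝒢.G, TopOut.mk c𝒢.G β = ρ𝒢 a ∧
      ∃ β' : contMulAut cℋ.G, TopOut.mk cℋ.G β' = ρℋ (e a) ∧
        ∀ y, (β' : MulAut cℋ.G) (φ.toMonoidHom y) = φ.toMonoidHom ((β : MulAut c𝒢.G) y) := by
  intro a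
  obtain ⟨β, cγ, hβ, hβγ, ⟨eγ⟩⟩ := hrep𝒢 a
  obtain ⟨β', cη, hβ', hβη, ⟨eη⟩⟩ := hrepℋ a
  obtain ⟨s⟩ := hsq a
  -- `c_η ∘ φ̂ = conj k ∘ φ̂ ∘ c_γ` (Prop 3.2 on the square, read on the representatives)
  obtain ⟨k, hk⟩ := exists_conj_of_resSquare c𝒢 cℋ φ cγ cη
    ⟨Functor.isoWhiskerLeft _ eγ.symm ≪≫ s ≪≫ Functor.isoWhiskerRight eη _⟩
  refine ⟨β, hβ, ⟨MulAut.conj k⁻¹, innerAut_le_contMulAut cℋ.G ⟨k⁻¹, rfl⟩⟩ * β', ?_, fun y => ?_⟩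
  · rw [map_mul, hβ', mul_eq_right, QuotientGroup.mk'_apply, QuotientGroup.eq_one_iff]
    exact ⟨k⁻¹, rfl⟩
  · change k⁻¹ * (β' : MulAut cℋ.G) (φ y) * k⁻¹⁻¹ = φ ((β : MulAut c𝒢.G) y)
    rw [hβη, hk, hβγ, inv_inv]
    group

omit [Group PA] in
/-- **The functorial squares from a dictionary of arrows** (the umbrella's currency): for a dictionary
`dict : I → Hom 𝒢 ℋ` with 2-cells `θd`, chart representatives `φc i` (`(dict i)^*_θ ≅ B^temp(φc i)`),
functoriality 2-isomorphisms `hpre` / `hpost` w.r.t. the graph actions (pre- and post-composition `pre a`, `post a`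
on the index), and an index `i₀` that is `Π_A`-EQUIVARIANT (`pre a i₀ = post a i₀` — for the arrow
`g₀ = φ.geom` of a morphism of arithmetic semi-graphs of anabelioids this is `ArithHom.compat`), the square
`B^temp(φc i₀) ⋙ (F_𝒢 a)^*_θ ≅ (F_ℋ a)^*_θ ⋙ B^temp(φc i₀)` holds for every `a` — the input `hsq` of
`btemp_representatives_of_squares`. [cite: MochizukiSemiAnbd2006, Thm 5.4 (iii) p.66] -/
theorem squares_of_dict {I : Type*} (F𝒢 : PA → Hom 𝒢 𝒢) (θ𝒢 : ∀ a, (F𝒢 a).ConjugatorFamily)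
    (Fℋ : PA → Hom ℋ ℋ) (θℋ : ∀ a, (Fℋ a).ConjugatorFamily)
    (dict : I → Hom 𝒢 ℋ) (θd : ∀ i, (dict i).ConjugatorFamily) (φc : I → (c𝒢.G →ₜ* cℋ.G))
    (hφc : ∀ i, Nonempty ((dict i).chartPullbackWith (θd i) c𝒢 cℋ ≅ BTemp.res (φc i)))
    (pre post : PA → I → I)
    (hpre : ∀ (a : PA) (i : I), Nonempty ((dict (pre a i)).chartPullbackWith (θd (pre a i)) c𝒢 cℋ ≅
      (dict i).chartPullbackWith (θd i) c𝒢 cℋ ⋙ (F𝒢 a).chartPullbackWith (θ𝒢 a) c𝒢 c𝒢))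
    (hpost : ∀ (a : PA) (i : I), Nonempty ((dict (post a i)).chartPullbackWith (θd (post a i)) c𝒢 cℋ ≅
      (Fℋ a).chartPullbackWith (θℋ a) cℋ cℋ ⋙ (dict i).chartPullbackWith (θd i) c𝒢 cℋ))
    (i₀ : I) (heq : ∀ a, pre a i₀ = post a i₀) :
    ∀ a, Nonempty (BTemp.res (φc i₀) ⋙ (F𝒢 a).chartPullbackWith (θ𝒢 a) c𝒢 c𝒢 ≅
      (Fℋ a).chartPullbackWith (θℋ a) cℋ cℋ ⋙ BTemp.res (φc i₀)) := by
  intro a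
  obtain ⟨e₀⟩ := hφc i₀
  obtain ⟨e₁⟩ := hpre a i₀
  have h₂ : Nonempty ((dict (pre a i₀)).chartPullbackWith (θd (pre a i₀)) c𝒢 cℋ ≅
      (Fℋ a).chartPullbackWith (θℋ a) cℋ cℋ ⋙ (dict i₀).chartPullbackWith (θd i₀) c𝒢 cℋ) := by
    rw [heq a]
    exact hpost a i₀
  obtain ⟨e₂⟩ := h₂
  exact ⟨Functor.isoWhiskerRight e₀.symm _ ≪≫ e₁.symm ≪≫ e₂ ≪≫ Functor.isoWhiskerLeft _ e₀⟩

/-- **Assembly**: `hrep` for `φ̂ := φc i₀` straight from the dictionary data (`squares_of_dict` +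
`btemp_representatives_of_squares`). [cite: MochizukiSemiAnbd2006, Thm 5.4 (iii) p.66] -/
theorem btemp_representatives_of_dict [IsTopologicalGroup cℋ.G] {I : Type*}
    (F𝒢 : PA → Hom 𝒢 𝒢) (θ𝒢 : ∀ a, (F𝒢 a).ConjugatorFamily)
    (Fℋ : PA → Hom ℋ ℋ) (θℋ : ∀ a, (Fℋ a).ConjugatorFamily)
    (hrep𝒢 : ∀ a, ∃ (β : contMulAut c𝒢.G) (cγ : c𝒢.G →ₜ* c𝒢.G), TopOut.mk c𝒢.G β = ρ𝒢 a ∧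
      (∀ t, (β : MulAut c𝒢.G) t = cγ t) ∧ Nonempty ((F𝒢 a).chartPullbackWith (θ𝒢 a) c𝒢 c𝒢 ≅ BTemp.res cγ))
    (hrepℋ : ∀ a, ∃ (β' : contMulAut cℋ.G) (cη : cℋ.G →ₜ* cℋ.G), TopOut.mk cℋ.G β' = ρℋ (e a) ∧
      (∀ t, (β' : MulAut cℋ.G) t = cη t) ∧ Nonempty ((Fℋ a).chartPullbackWith (θℋ a) cℋ cℋ ≅ BTemp.res cη))
    (dict : I → Hom 𝒢 ℋ) (θd : ∀ i, (dict i).ConjugatorFamily) (φc : I → (c𝒢.G →ₜ* cℋ.G))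
    (hφc : ∀ i, Nonempty ((dict i).chartPullbackWith (θd i) c𝒢 cℋ ≅ BTemp.res (φc i)))
    (pre post : PA → I → I)
    (hpre : ∀ (a : PA) (i : I), Nonempty ((dict (pre a i)).chartPullbackWith (θd (pre a i)) c𝒢 cℋ ≅
      (dict i).chartPullbackWith (θd i) c𝒢 cℋ ⋙ (F𝒢 a).chartPullbackWith (θ𝒢 a) c𝒢 c𝒢))
    (hpost : ∀ (a : PA) (i : I), Nonempty ((dict (post a i)).chartPullbackWith (θd (post a i)) c𝒢 cℋ ≅
      (Fℋ a).chartPullbackWith (θℋ a) cℋ cℋ ⋙ (dict i).chartPullbackWith (θd i) c𝒢 cℋ))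
    (i₀ : I) (heq : ∀ a, pre a i₀ = post a i₀) :
    ∀ a : PA, ∃ β : contMulAut c𝒢.G, TopOut.mk c𝒢.G β = ρ𝒢 a ∧
      ∃ β' : contMulAut cℋ.G, TopOut.mk cℋ.G β' = ρℋ (e a) ∧
        ∀ y, (β' : MulAut cℋ.G) ((φc i₀).toMonoidHom y) = (φc i₀).toMonoidHom ((β : MulAut c𝒢.G) y) :=
  btemp_representatives_of_squares c𝒢 cℋ ρ𝒢 ρℋ e (φc i₀) F𝒢 θ𝒢 Fℋ θℋ hrep𝒢 hrepℋ
    (squares_of_dict c𝒢 cℋ F𝒢 θ𝒢 Fℋ θℋ dict θd φc hφc pre post hpre hpost i₀ heq)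

end ProfiniteSemiGraph

end Literature.AnabelianGeometry.SemiGraphs
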